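import Summits.ResolutionOfSingularities.ResolutionOfSingularities.Theorems.HilbertSamuelEliminationSigmaMaxModificationsCorridor3Directrix214SharpNearFibre
import Summits.ResolutionOfSingularities.ResolutionOfSingularities.Theorems.HilbertSamuelEliminationCampaignW42Theorem314NumericalOfDirDimEq
import HarnessLib

/-!
# [OURS · L1 W4.2] CJS Thm. 3.14, NEAR-FIBRE form for an ARBITRARY permissible centre, in the regime (F3) `e_x(X) = ē_x(X)`:
# if `e_x(X) ≤ dim 𝒪_{D,x} + 1` the near points over `x` form a SUBSINGLETON and the near point is `κ(x)`-RATIONAL —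
# every characteristic, NO characteristic hypothesis, NO named fact (campaign s42, cell res-hironaka; informal crux
# `RidgeConfinement`, stmt-ResolutionOfSingularities-17845; e = ē twin of the w42 binders F-61 `Thm314_nearFibre_subsingleton` /
# `Moving.Theorem314_nearFibre_geomDir`, crux 19249; `--supports`)

HONEST FRAMING. OURS (slot W4.2, prover res-L1-s42-pv-1, gen 4). res-L1-w42-stub-3's `…Corridor3Directrix214SharpNearFibre`
(`theorem314_nearFibre_geomDir_and_isIso_of_facts`) proves the near-fibre clause of 2.14♯ for an arbitrary permissible centre
under (F1♯) MODULO F-51′ (Hironaka 1970 Th. IV) and F-split: its only use of F-51′/(F1♯) is the seam `𝒯(J_D) ⊆ 𝔭_{x'}`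
(`directrixSpace_normalCone_le_chartPrime_of_near`). This file re-runs stub-3's assembly VERBATIM (with attribution) with that
seam replaced by this campaign's FACT-FREE seam under `e_x(X) = ē_x(X)`
(`CampaignW42.directrixSpace_normalConeIdeal_le_chartPrime_of_dirDim_eq_geomDirDim`, p525975: ridge confinement in the fibre
cone + `𝒯(J_D) ⊆ √𝔉(J_D)`) and F-split supplied by the tree theorem `HerrmannIkedaOrbanz1988_cor_21_11_holds`:

* `one_le_directrixDim_normalCone_of_near_of_dirDim_eq_geomDirDim`, `near_point_chart_exports_of_dirDim_eq_geomDirDim` — stub-3's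
  lemmas with the seam swapped;
* **`nearFibre_subsingleton_and_isIso_of_dirDim_eq_geomDirDim`** — `X` excellent, `D` permissible, `π` a blow-up in `D`, `x ∈ V(D)`
  (closed OR NOT) with `e_x(X) = ē_x(X)` and `e_x(X) ≤ dim 𝒪_{D,x} + 1`: at every level `N` the points over `x` near to `x` form a
  subsingleton, and at such a point `κ(x) → κ(x')` is an isomorphism. No `dim X ≤ N`, no characteristic clause, no binder.

NOTHING here is a statement of H. Hironaka's manuscript [Hironaka2017]. AI review is weaker than expert review. References
(orientation only): V. Cossart, U. Jannsen, S. Saito, LNM 2270 (2020), Thm. 3.14, p. 103 L32, §6.3 (F3); Stacks Project Tag 0804.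
-/

set_option linter.dupNamespace false

noncomputable section

open CategoryTheory AlgebraicGeometry TopologicalSpace IsLocalRing MvPolynomial
open Literature.AlgebraicGeometry.Resolution Literature.AlgebraicGeometry.Resolution.HironakaScheme
open Literature.RingTheory.HilbertSamuel Literature.RingTheory.MvPolynomial
open Literature.AlgebraicGeometry.CossartJannsenSaito2020
open Summit.ResolutionOfSingularities.ResolutionOfSingularities.Theorems.SigmaMaxModificationsCorridor3.Directrix214Sharp

namespace Summit.ResolutionOfSingularities.ResolutionOfSingularities.Theorems

namespace CampaignW42

universe u

/-! ## stub-3's lemmas with the fact-free `e = ē` seam -/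

/-- **A near point forces `e(J_D) ≥ 1`** when `e_x = ē_x` (the prime `𝔭_{x'}` contains `𝒯(J_D)` and misses a variable) —
res-L1-w42-stub-3's `one_le_directrixDim_normalCone_of_near` with the F-51′ seam replaced by the fact-free one.
[cite: CossartJannsenSaito2020, Thm. 3.14, Lemma 3.15 (2)] -/
theorem one_le_directrixDim_normalCone_of_near_of_dirDim_eq_geomDirDim
    {X X' : Scheme.{u}} [IsLocallyNoetherian X] {π : X' ⟶ X} {D : X.IdealSheafData} {N : ℕ}
    (hexc : Scheme.IsExcellent X) (hperm : IdealSheafData.IsPermissible D) (hπ : IsBlowup π D)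
    {x' : X'} (hxD : π.base x' ∈ (D.support : Set X))
    (heq : Scheme.dirDim X (π.base x') = Scheme.geomDirDim X (π.base x'))
    {n : ℕ} {g : Fin (n + 1) → X.presheaf.stalk (π.base x')}
    (hgI : Ideal.span (Set.range g) = stalkIdeal D (π.base x')) (hn : (stalkIdeal D (π.base x')).spanFinrank = n + 1)
    (hnear : Scheme.hsFun X' N x' = Scheme.hsFun X N (π.base x')) :
    1 ≤ directrixDim (normalConeIdeal g) := by
  haveI : IsLocalHom (π.stalkMap x').hom := π.toLRSHom.prop x'
  obtain ⟨t, ht, hspan⟩ := hπ.isEffectiveCartier.exists_stalkIdeal_eq_span x'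
  have hmap : (stalkIdeal D (π.base x')).map (π.stalkMap x').hom = Ideal.span {t} := by
    rw [← hspan, stalkIdeal_comap_eq_map_stalkMap]
  have hu : ∀ i, ∃ ui : X'.presheaf.stalk x', (π.stalkMap x').hom (g i) = ui * t := by
    intro i
    have hmem : (π.stalkMap x').hom (g i) ∈ (stalkIdeal D (π.base x')).map (π.stalkMap x').hom := by
      refine Ideal.mem_map_of_mem _ ?_
      rw [← hgI]
      exact Ideal.subset_span ⟨i, rfl⟩
    rw [hmap, Ideal.mem_span_singleton'] at hmem
    obtain ⟨ui, hui⟩ := hmem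
    exact ⟨ui, hui.symm⟩
  choose u hu using hu
  have hcore := directrixSpace_normalConeIdeal_le_chartPrime_of_dirDim_eq_geomDirDim hexc hperm hπ x' hxD heq hnear
    g hgI hn t ht hmap u hu
  obtain ⟨i₀, hi₀⟩ := exists_X_not_mem_chartPrime_of_map_eq (π.stalkMap x').hom hgI ht hmap hu
  exact one_le_directrixDim_of_not_mem ((mem_homogeneousSubmodule 1 _).mpr (isHomogeneous_X _ i₀))
    fun h => hi₀ (hcore _ h)


/-- **The exports of a near point** for the chart argument (general centre, `e(J_D) = 1`), `e = ē` version of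
res-L1-w42-stub-3's `near_point_chart_exports`: (1) the exceptional ideal at `x'` is generated by `π^♯(c_j)`; (2) a ring map
`φ : 𝒪_{X,x} → 𝒪_{X',x'}` over `π^♯ ∘ germ`, with values in the image of `π^♯_{x'}`, in which `c_k ≡ β_k c_j` modulo `(c_j)·𝔪_{x'}`.
[cite: CossartJannsenSaito2020, Thm. 3.14, p. 103 L32] -/
theorem near_point_chart_exports_of_dirDim_eq_geomDirDim
    {X X' : Scheme.{u}} [IsLocallyNoetherian X] {π : X' ⟶ X} {D : X.IdealSheafData} {N : ℕ}
    (hexc : Scheme.IsExcellent X) (hperm : IdealSheafData.IsPermissible D) (hπ : IsBlowup π D)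
    (U : X.affineOpens) {x : X} (hxU : x ∈ (U : X.Opens)) [Algebra Γ(X, U) (X.presheaf.stalk x)]
    (halg : ∀ s : Γ(X, U), algebraMap Γ(X, U) (X.presheaf.stalk x) s = (X.presheaf.germ U x hxU).hom s)
    (hxD : x ∈ (D.support : Set X)) (heq : Scheme.dirDim X x = Scheme.geomDirDim X x)
    {n r : ℕ} {g : Fin (n + 1) → X.presheaf.stalk x}
    (hgI : Ideal.span (Set.range g) = stalkIdeal D x) (hn : (stalkIdeal D x).spanFinrank = n + 1)
    (hd : directrixDim (normalConeIdeal g) = 1)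
    {c : Fin r → Γ(X, U)} (j : Fin r) {a : Fin (n + 1) → X.presheaf.stalk x}
    (hta : algebraMap Γ(X, U) (X.presheaf.stalk x) (c j) = ∑ i, a i * g i)
    (hℓ : linForm (fun i => residue (X.presheaf.stalk x) (a i)) ∉ directrixSpace (normalConeIdeal g))
    (β : Fin r → X.presheaf.stalk x)
    (hβ : ∀ (k : Fin r) (B : Type u) [CommRing B] [IsLocalRing B] (φ : X.presheaf.stalk x →+* B) [IsLocalHom φ]
      (t : B) (u : Fin (n + 1) → B),
      (Ideal.span (Set.range g)).map φ = Ideal.span {t} → (∀ i, φ (g i) = u i * t) →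
      (∀ L ∈ directrixSpace (normalConeIdeal g), L ∈ chartPrime φ u) →
        φ (algebraMap Γ(X, U) (X.presheaf.stalk x) (c k)) -
            φ (β k) * φ (algebraMap Γ(X, U) (X.presheaf.stalk x) (c j)) ∈
          Ideal.span {φ (algebraMap Γ(X, U) (X.presheaf.stalk x) (c j))} * maximalIdeal B)
    {x' : X'} (hx : π.base x' = x) (hx'U : π x' ∈ (U : X.Opens))
    (hnear : Scheme.hsFun X' N x' = Scheme.hsFun X N x) :
    stalkIdeal (D.comap π) x' = Ideal.span {(π.stalkMap x').hom ((X.presheaf.germ U (π x') hx'U).hom (c j))} ∧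
    ∃ φ : X.presheaf.stalk x →+* X'.presheaf.stalk x',
      (∀ s : Γ(X, U), φ (algebraMap Γ(X, U) (X.presheaf.stalk x) s) =
        (π.stalkMap x').hom ((X.presheaf.germ U (π x') hx'U).hom s)) ∧
      (∀ k, φ (algebraMap Γ(X, U) (X.presheaf.stalk x) (c k)) -
            φ (β k) * φ (algebraMap Γ(X, U) (X.presheaf.stalk x) (c j)) ∈
          Ideal.span {φ (algebraMap Γ(X, U) (X.presheaf.stalk x) (c j))} *
            maximalIdeal (X'.presheaf.stalk x')) ∧
      ∀ a₀ : X.presheaf.stalk x, ∃ a' : X.presheaf.stalk (π x'), (π.stalkMap x').hom a' = φ a₀ := by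
  subst hx
  haveI : IsLocalHom (π.stalkMap x').hom := π.toLRSHom.prop x'
  -- the chart of the exceptional divisor at `x'`
  obtain ⟨t, ht, hspan⟩ := hπ.isEffectiveCartier.exists_stalkIdeal_eq_span x'
  have hmap : (stalkIdeal D (π.base x')).map (π.stalkMap x').hom = Ideal.span {t} := by
    rw [← hspan, stalkIdeal_comap_eq_map_stalkMap]
  have hu : ∀ i, ∃ ui : X'.presheaf.stalk x', (π.stalkMap x').hom (g i) = ui * t := by
    intro i
    have hmem : (π.stalkMap x').hom (g i) ∈ (stalkIdeal D (π.base x')).map (π.stalkMap x').hom := by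
      refine Ideal.mem_map_of_mem _ ?_
      rw [← hgI]
      exact Ideal.subset_span ⟨i, rfl⟩
    rw [hmap, Ideal.mem_span_singleton'] at hmem
    obtain ⟨ui, hui⟩ := hmem
    exact ⟨ui, hui.symm⟩
  choose u hu using hu
  -- the directrix space lies in `𝔭_{x'}`
  have hcore := directrixSpace_normalConeIdeal_le_chartPrime_of_dirDim_eq_geomDirDim hexc hperm hπ x' hxD heq hnear
    g hgI hn t ht hmap u hu
  have hmap' : (Ideal.span (Set.range g)).map (π.stalkMap x').hom = Ideal.span {t} := by rw [hgI, hmap]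
  -- (1) the exceptional ideal is generated by `π^♯(c_j)`
  have hgen : (Ideal.span (Set.range g)).map (π.stalkMap x').hom =
      Ideal.span {(π.stalkMap x').hom (algebraMap Γ(X, U) (X.presheaf.stalk (π.base x')) (c j))} :=
    map_span_eq_span_of_normalCone hd hta hℓ (π.stalkMap x').hom hmap' hu hcore
  refine ⟨?_, (π.stalkMap x').hom, fun sec => ?_, fun k => ?_, fun a₀ => ⟨a₀, rfl⟩⟩
  · rw [stalkIdeal_comap_eq_map_stalkMap, ← hgI, hgen, halg]
  · exact congrArg _ (halg sec)
  · exact hβ k _ (π.stalkMap x').hom t u hmap' hu hcore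


/-! ## The theorem -/

set_option maxHeartbeats 800000 in
-- one long assembly over the large chart types (the Rees chart `chartRing c j` over `Γ(X, U)`), as for `projDir_line`
/-- **CJS Thm. 3.14, NEAR-FIBRE form, arbitrary permissible centre, (F3) regime — fact-free.** For `X` locally noetherian and
excellent, `D` permissible, `π : X' → X` a blow-up in `D`, any `N`, `x ∈ V(D)` with **`e_x(X) = ē_x(X)`** and
`e_x(X) ≤ dim(𝒪_{X,x}/I_x) + 1`: the set of points `x' ∈ π⁻¹(x)` with `H^N_{X'}(x') = H^N_X(x)` is a SUBSINGLETON, and at such a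
point `κ(x) → κ(x')` is an isomorphism («`x' ∈ ℙ(Dir_x(X)/T_x(D)) = ℙ⁰_{κ(x)}`»). res-L1-w42-stub-3's assembly
(`theorem314_nearFibre_geomDir_and_isIso_of_facts`) with the seam swapped; every characteristic, no named fact.
[cite: CossartJannsenSaito2020, Thm. 3.14 (p. 51), p. 103 L32, §6.3 (F3)] -/
theorem nearFibre_subsingleton_and_isIso_of_dirDim_eq_geomDirDim
    {X X' : Scheme.{u}} [IsLocallyNoetherian X] (π : X' ⟶ X) (D : X.IdealSheafData)
    (hexc : Scheme.IsExcellent X) (hperm : IdealSheafData.IsPermissible D) (hπ : IsBlowup π D)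
    (N : ℕ) (x : X) (hxD : x ∈ D.support) (heq : Scheme.dirDim X x = Scheme.geomDirDim X x)
    (he : (Scheme.dirDim X x : WithBot ℕ∞) ≤ ringKrullDim (X.presheaf.stalk x ⧸ stalkIdeal D x) + 1) :
    {x' : X' | π.base x' = x ∧ Scheme.hsFun X' N x' = Scheme.hsFun X N x}.Subsingleton ∧
      ∀ x' : X', π.base x' = x → Scheme.hsFun X' N x' = Scheme.hsFun X N x → IsIso (π.residueFieldMap x') := by
  classical
  suffices main : ∀ x₁ : X', π.base x₁ = x → Scheme.hsFun X' N x₁ = Scheme.hsFun X N x →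
      (∀ x₂ : X', π.base x₂ = x → Scheme.hsFun X' N x₂ = Scheme.hsFun X N x → x₁ = x₂) ∧
        IsIso (π.residueFieldMap x₁) by
    exact ⟨fun x₁ h₁ x₂ h₂ => (main x₁ h₁.1 h₁.2).1 x₂ h₂.1 h₂.2, fun x' h hn => (main x' h hn).2⟩
  intro x₁ hx₁ hn₁
  subst hx₁
  -- (0) an affine open `U ∋ x`, `𝔭 = 𝔭_x ⊆ R = Γ(X, U)`, `𝒪_{X,x} = R_𝔭`
  obtain ⟨U, hxU⟩ : ∃ U : X.affineOpens, π.base x₁ ∈ (U : X.Opens) := by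
    obtain ⟨U₀, hU, hxU, -⟩ :=
      exists_isAffineOpen_mem_and_subset (X := X) (x := π.base x₁) (U := ⊤) (Opens.mem_top _)
    exact ⟨⟨U₀, hU⟩, hxU⟩
  obtain ⟨𝔭, h𝔭⟩ : ∃ 𝔭 : PrimeSpectrum Γ(X, U), 𝔭 = U.2.primeIdealOf ⟨π.base x₁, hxU⟩ := ⟨_, rfl⟩
  haveI : IsNoetherianRing Γ(X, U) := IsLocallyNoetherian.component_noetherian U
  set A := X.presheaf.stalk (π.base x₁) with hA
  letI : Algebra Γ(X, U) A := TopCat.Presheaf.algebra_section_stalk X.presheaf (⟨π.base x₁, hxU⟩ : (U : X.Opens))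
  haveI hloc : IsLocalization.AtPrime A 𝔭.asIdeal := h𝔭 ▸ U.2.isLocalization_stalk ⟨π.base x₁, hxU⟩
  have halg : ∀ s : Γ(X, U), algebraMap Γ(X, U) A s = (X.presheaf.germ U (π.base x₁) hxU).hom s := fun _ => rfl
  -- `I = I_{D,x}`, generators `c` of `D(U)`
  set I : Ideal A := stalkIdeal D (π.base x₁) with hI
  have hIperm : I.IsPermissible := hperm _ hxD
  obtain ⟨r, c, hc⟩ : ∃ (r : ℕ) (c : Fin r → Γ(X, U)), Ideal.span (Set.range c) = D.ideal U :=
    Submodule.fg_iff_exists_fin_generating_family.mp (IsNoetherian.noetherian (D.ideal U))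
  have hIc : D.ideal U = Ideal.span (Set.range c) := hc.symm
  have hspanA : Ideal.span (Set.range fun l => algebraMap Γ(X, U) A (c l)) = I := by
    rw [hI, stalkIdeal_eq_map_germ D U hxU, hIc, Ideal.map_span, ← Set.range_comp]
    rfl
  have hcm : ∀ l, algebraMap Γ(X, U) A (c l) ∈ I := fun l => hspanA ▸ Ideal.subset_span ⟨l, rfl⟩
  -- minimal generators `g` of `I`, the numerics of F-split
  obtain ⟨n, s, g, y, hz, hgI, hn, hdimI, hE, hJz⟩ := exists_minimal_generators_data HerrmannIkedaOrbanz1988_cor_21_11_holds hIperm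
  have hm : (Ideal.span (Set.range g)).spanFinrank = n + 1 := by rw [hgI, hn]
  have hdle : directrixDim (normalConeIdeal g) ≤ 1 := directrixDim_normalCone_le_one hdimI hE hJz he
  have hone : 1 ≤ directrixDim (normalConeIdeal g) :=
    one_le_directrixDim_normalCone_of_near_of_dirDim_eq_geomDirDim hexc hperm hπ hxD heq hgI hn hn₁
  have hd : directrixDim (normalConeIdeal g) = 1 := le_antisymm hdle hone
  -- expansions `c_l = Σ_i a_{li} g_i`
  have hexp : ∀ l, ∃ a : Fin (n + 1) → A, ∑ i, a i * g i = algebraMap Γ(X, U) A (c l) :=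
    fun l => Ideal.mem_span_range_iff_exists_fun.mp (by rw [hgI]; exact hcm l)
  choose a ha using hexp
  -- (1) a section `c_j` whose symbol is off the hyperplane `𝒯(J_D)`
  have hcg : Ideal.span (Set.range fun l => algebraMap Γ(X, U) A (c l)) = Ideal.span (Set.range g) := by
    rw [hspanA, hgI]
  obtain ⟨j, hj⟩ := exists_linForm_notMem_directrixSpace_normalCone hm hone hcg a (fun l => (ha l).symm)
  -- (2) the chart at `c_j`
  obtain ⟨gch, hgopen, hgπ, hgmem⟩ := exists_chart_of_ideal_eq_span' hπ U c hIc j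
  haveI := hgopen
  -- (3) the ratios `β_k` and fractions `β_k = r_k / s_k`
  have hβex := fun k => exists_forall_sub_mul_mem_normalCone.{u, u} hd (ha j).symm hj
    (show algebraMap Γ(X, U) A (c k) ∈ Ideal.span (Set.range g) by rw [hgI]; exact hcm k)
  choose β hβ using hβex
  have hrsex := fun k => IsLocalization.surj 𝔭.asIdeal.primeCompl (β k)
  choose rs hrs using hrsex
  -- a point of the chart over `x` lies over `𝔭`
  have hw𝔭 : ∀ (w : Spec (.of (chartRing c j))), π.base (gch w) = π.base x₁ →
      w.asIdeal.comap (CommRingCat.ofHom (chartBase c j)).hom = 𝔭.asIdeal := by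
    intro w hx
    have h1 : (gch ≫ π) w = π.base x₁ := by
      rw [Scheme.Hom.comp_apply]
      exact hx
    rw [hgπ, Scheme.Hom.comp_apply, Spec.map_apply] at h1
    have h2 : PrimeSpectrum.comap (CommRingCat.ofHom (chartBase c j)).hom w ∈ U.2.fromSpec ⁻¹' {π.base x₁} := h1
    rw [fromSpec_preimage_singleton U.2 hxU] at h2
    exact congrArg PrimeSpectrum.asIdeal ((Set.mem_singleton_iff.mp h2).trans h𝔭.symm)
  -- (K) every near point over `x` lies on the chart, at a prime over `𝔭` containing `𝔑`, with residue field `k(x)`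
  have K : ∀ (x' : X') (hx : π.base x' = π.base x₁), Scheme.hsFun X' N x' = Scheme.hsFun X N (π.base x₁) →
      ∃ w : Spec (.of (chartRing c j)), gch w = x' ∧
        𝔭.asIdeal.map (CommRingCat.ofHom (chartBase c j)).hom ⊔ Ideal.span (Set.range fun k =>
            (CommRingCat.ofHom (chartBase c j)).hom ((rs k).2 : Γ(X, U)) * chartGen c j k -
              (CommRingCat.ofHom (chartBase c j)).hom (rs k).1) ≤ w.asIdeal ∧
        IsIso (π.residueFieldMap (gch w)) := by
    intro x' hx hn'
    have hx'U : π x' ∈ (U : X.Opens) := by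
      have h := hxU
      rw [← hx] at h
      exact h
    obtain ⟨E1, φ, hφgerm, hβφ, hφlift⟩ := near_point_chart_exports_of_dirDim_eq_geomDirDim hexc hperm hπ U hxU halg hxD heq
      hgI hn hd j (ha j).symm hj β hβ hx hx'U hn'
    -- (K1) on the chart
    obtain ⟨w, rfl⟩ : x' ∈ Set.range gch := hgmem x' hx'U E1
    -- (K2) `𝔑 ≤ w` and the residue field
    have hN := rationalIdeal_le_of_chart π U (CommRingCat.ofHom (chartBase c j)) gch hgπ c j
      (fun k => chartGen c j k) (fun k => reesChartBase_apply_eq_mul_chartGen c j k)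
      (reesChartBase_mem_nonZeroDivisors (c j) (Ideal.mem_span_range_self (f := c) (x := j)))
      w hx'U 𝔭.asIdeal (hw𝔭 w hx) (A := A) φ hφgerm β rs hβφ hrs
    refine ⟨w, rfl, hN, ?_⟩
    exact isIso_residueFieldMap_of_chart π U (CommRingCat.ofHom (chartBase c j)) gch hgπ j
      (fun k => chartGen c j k) (eval₂Hom_chartGen_surjective c j) w hx'U 𝔭.asIdeal (hw𝔭 w hx) (A := A) φ hφgerm rs hN
      hφlift
  -- conclusion
  obtain ⟨w₁, hw₁, hN₁, hiso₁⟩ := K x₁ rfl hn₁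
  refine ⟨fun x₂ hx₂ hn₂ => ?_, hw₁ ▸ hiso₁⟩
  obtain ⟨w₂, hw₂, hN₂, -⟩ := K x₂ hx₂ hn₂
  rw [← hw₁, ← hw₂]
  haveI := w₁.isPrime
  haveI := w₂.isPrime
  rw [PrimeSpectrum.ext (eq_of_comap_eq_of_rationalIdeal_le (CommRingCat.ofHom (chartBase c j)).hom j
    (fun k => chartGen c j k) 𝔭.asIdeal rs (eval₂Hom_chartGen_surjective c j)
    (hw𝔭 w₁ (by rw [hw₁])) (hw𝔭 w₂ (by rw [hw₂, hx₂])) hN₁ hN₂)]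


end CampaignW42

end Summit.ResolutionOfSingularities.ResolutionOfSingularities.Theorems

end
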